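import Summits.FinalStateConjecture.FinalStateConjecture.Theses.HarmonicFluxCensus
import Literature.Geometry.Lorentzian.MaximalDataScalarCurvature
import Literature.Geometry.Lorentzian.AsymptoticFlatness

open scoped Manifold ContDiff Topology BigOperators ENNReal Classical
open Set Filter MeasureTheory

noncomputable section

namespace Summit.FinalStateConjecture.FinalStateConjecture.Cruxes.BoundedCensusGeometry.Split

/-!
# Birth skeleton of piece 3 `CheapWitnessPerCount` (split of `BoundedCensusGeometry`, stmt-17468)
-/

/-- Piece 3 of the split (verbatim the child statement to be filed on the route). -/
def CheapWitnessPerCount : Prop :=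
  ∀ (X : Type) [TopologicalSpace X] [ChartedSpace (EuclideanSpace ℝ (Fin 3)) X] [IsManifold (𝓡 3) ((⊤ : ENat) : WithTop ENat) X] [T2Space X] [SecondCountableTopology X] [ConnectedSpace X] (D : Literature.Geometry.Lorentzian.InitialDataSet (𝓡 3) X), D ∈ Literature.Geometry.Lorentzian.admissibleVacuumData X → ∀ 𝒟 : Literature.Geometry.Lorentzian.VacuumCauchyDevelopment D, 𝒟.IsMaximal → ∀ m : ℕ, ∃ c₁ Q₀ : ℝ, ∀ (X' : Type) [TopologicalSpace X'] [ChartedSpace (EuclideanSpace ℝ (Fin 3)) X'] [IsManifold (𝓡 3) ((⊤ : ENat) : WithTop ENat) X'] [ConnectedSpace X'] (D' : Literature.Geometry.Lorentzian.InitialDataSet (𝓡 3) X') (𝒟' : Literature.Geometry.Lorentzian.CauchyDevelopment D'), 𝒟'.toSpacetime = 𝒟.toSpacetime → ∀ (S : Fin m → Literature.Geometry.Lorentzian.OutermostMOTS (𝓡 3) D'.h D'.k), (∀ j, ConnectedSpace (S j).surf) → (∀ j, IsCompact (((S j).exterior : Set X'))ᶜ ∧ (interior (((S j).exterior : Set X'))ᶜ).Nonempty)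 → Pairwise (fun j j' ↦ Disjoint (((S j).exterior : Set X'))ᶜ (((S j').exterior : Set X'))ᶜ) → ∃ (X'' : Type) (_ : TopologicalSpace X'') (_ : ChartedSpace (EuclideanSpace ℝ (Fin 3)) X'') (_ : IsManifold (𝓡 3) ((⊤ : ENat) : WithTop ENat) X'') (_ : T2Space X'') (_ : LocallyCompactSpace X'') (_ : MeasurableSpace X'') (_ : BorelSpace X'') (_ : ConnectedSpace X'') (D'' : Literature.Geometry.Lorentzian.InitialDataSet (𝓡 3) X'') (𝒟'' : Literature.Geometry.Lorentzian.CauchyDevelopment D'') (_ : D''.metric.HasLeviCivita), 𝒟''.toSpacetime = 𝒟.toSpacetime ∧ D''.IsComplete ∧ ∃ S'' : Fin m → Literature.Geometry.Lorentzian.OutermostMOTS (𝓡 3) D''.h D''.k, (∀ j, ConnectedSpace (S'' j).surf) ∧ (∀ j, IsCompact (((S'' j).exterior : Set X''))ᶜ ∧ (interior (((S'' j).exterior : Set X''))ᶜ).Nonempty) ∧ Pairwise (fun j j' ↦ Disjoint (((S'' j).exterior : Set X''))ᶜ (((S'' j').exterior : Set X''))ᶜ) ∧ (∀ ζ : X''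 → ℝ, ContMDiff (𝓡 3) 𝓘(ℝ, ℝ) 1 ζ → HasCompactSupport ζ → (∫⁻ x in ⋂ j, ((S'' j).exterior : Set X''), ENNReal.ofReal (|ζ x| ^ 6) ∂(Literature.Geometry.Lorentzian.riemannianMeasure D''.h)) ^ (1 / 3 : ℝ) ≤ ENNReal.ofReal c₁ * ∫⁻ x in ⋂ j, ((S'' j).exterior : Set X''), ENNReal.ofReal (D''.metric.innerDual x (mvfderiv (𝓡 3) ζ x).toLinearMap (mvfderiv (𝓡 3) ζ x).toLinearMap) ∂(Literature.Geometry.Lorentzian.riemannianMeasure D''.h)) ∧ (∫⁻ x in ⋂ j, ((S'' j).exterior : Set X''), ENNReal.ofReal ((D''.metric.normSq x (D''.metric.ricci x)) ^ (3 / 4 : ℝ)) ∂(Literature.Geometry.Lorentzian.riemannianMeasure D''.h)) + ∑ j, (∫⁻ x in Set.range (S'' j).f, ENNReal.ofReal (D''.normSqK x) ∂(Literature.Geometry.Lorentzian.riemannianVolume D''.h 2)) ≤ ENNReal.ofReal Q₀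

/-- **stub C1 — bodies transfer to a complete asymptotically flat slice** (Lorentzian; no cost):
every family of `m` disjoint compact bodies bounded by connected outermost MOTSs on any Cauchy slice
of an MGHD of admissible data is matched by such a family of the SAME size on a COMPLETE Cauchy slice
of the same spacetime possessing a sole asymptotically flat end of some order `α > 0` (complete the
slice outside a large compact set; outermost-ness survives by the maximum principle against the
untrapped far foliation). -/
theorem stub_completeAFCarrier :
    ∀ (X : Type) [TopologicalSpace X] [ChartedSpace (EuclideanSpace ℝ (Fin 3)) X] [IsManifold (𝓡 3) ((⊤ : ENat) : WithTop ENat) X] [T2Space X] [SecondCountableTopology X] [ConnectedSpace X] (D : Literature.Geometry.Lorentzian.InitialDataSet (𝓡 3) X), D ∈ Literature.Geometry.Lorentzian.admissibleVacuumData X → ∀ 𝒟 : Literature.Geometry.Lorentzian.VacuumCauchyDevelopment D, 𝒟.IsMaximal → ∀ (X' : Type) [TopologicalSpace X'] [ChartedSpace (EuclideanSpace ℝ (Fin 3)) X'] [IsManifold (𝓡 3) ((⊤ : ENat) : WithTop ENat) X'] [ConnectedSpace X'] (D' : Literature.Geometry.Lorentzian.InitialDataSet (𝓡 3) X') (𝒟'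 : Literature.Geometry.Lorentzian.CauchyDevelopment D'), 𝒟'.toSpacetime = 𝒟.toSpacetime → ∀ (m : ℕ) (S : Fin m → Literature.Geometry.Lorentzian.OutermostMOTS (𝓡 3) D'.h D'.k), (∀ j, ConnectedSpace (S j).surf) → (∀ j, IsCompact (((S j).exterior : Set X'))ᶜ ∧ (interior (((S j).exterior : Set X'))ᶜ).Nonempty) → Pairwise (fun j j' ↦ Disjoint (((S j).exterior : Set X'))ᶜ (((S j').exterior : Set X'))ᶜ) → ∃ (X'' : Type) (_ : TopologicalSpace X'') (_ : ChartedSpace (EuclideanSpace ℝ (Fin 3)) X'') (_ : IsManifold (𝓡 3) ((⊤ : ENat) : WithTop ENat) X'') (_ : T2Space X'') (_ : LocallyCompactSpace X'') (_ : MeasurableSpace X'') (_ : BorelSpace X'') (_ : ConnectedSpace X'') (D'' : Literature.Geometry.Lorentzian.InitialDataSet (𝓡 3) X'') (𝒟'' : Literature.Geometry.Lorentzian.CauchyDevelopment D'') (_ : D''.metric.HasLeviCivita), 𝒟''.toSpacetime = 𝒟.toSpacetime ∧ D''.IsComplete ∧ (∃ (e : Literature.Geometry.Lorentzian.AFEnd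 X'') (α : ℝ), 0 < α ∧ e.IsSoleEnd ∧ e.IsMetricAsymptoticallyFlat D'' α) ∧ ∃ S'' : Fin m → Literature.Geometry.Lorentzian.OutermostMOTS (𝓡 3) D''.h D''.k, (∀ j, ConnectedSpace (S'' j).surf) ∧ (∀ j, IsCompact (((S'' j).exterior : Set X''))ᶜ ∧ (interior (((S'' j).exterior : Set X''))ᶜ).Nonempty) ∧ Pairwise (fun j j' ↦ Disjoint (((S'' j).exterior : Set X''))ᶜ (((S'' j').exterior : Set X''))ᶜ) := by
  sorry

/-- **stub C2 — finite census cost on complete one-ended asymptotically flat slices** (Riemannian,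
kinematic, theorem-sized): the common exterior of every body family on a complete data set with a
sole asymptotically flat end of order `α > 0` has a finite Neumann–Sobolev constant (extension across
the smooth compact boundary + Schoen–Yau 1979 Lemma 3.1, proved in `AFSobolev.lean`) and a finite
census functional (`|Ric|^{3/2} = O(r^{-3-3α/2})` is integrable; boundary terms are integrals of
continuous functions over compact surfaces). -/
theorem stub_finiteCostAF :
    ∀ (X'' : Type) [TopologicalSpace X''] [ChartedSpace (EuclideanSpace ℝ (Fin 3)) X''] [IsManifold (𝓡 3) ((⊤ : ENat) : WithTop ENat) X''] [T2Space X''] [LocallyCompactSpace X''] [MeasurableSpace X''] [BorelSpace X''] [ConnectedSpace X''] (D'' : Literature.Geometry.Lorentzian.InitialDataSet (𝓡 3) X''), (∀ [D''.metric.HasLeviCivita], D''.IsComplete → (∃ (e : Literature.Geometry.Lorentzian.AFEnd X'') (α : ℝ), 0 < α ∧ e.IsSoleEnd ∧ e.IsMetricAsymptoticallyFlat D'' α) → ∀ (m : ℕ) (S'' : Fin m → Literature.Geometry.Lorentzian.OutermostMOTS (𝓡 3) D''.h D''.k), (∀ j, ConnectedSpace (S'' j).surf) → (∀ j, IsCompact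 (((S'' j).exterior : Set X''))ᶜ ∧ (interior (((S'' j).exterior : Set X''))ᶜ).Nonempty) → Pairwise (fun j j' ↦ Disjoint (((S'' j).exterior : Set X''))ᶜ (((S'' j').exterior : Set X''))ᶜ) → ∃ c₁ Q₀ : ℝ, (∀ ζ : X'' → ℝ, ContMDiff (𝓡 3) 𝓘(ℝ, ℝ) 1 ζ → HasCompactSupport ζ → (∫⁻ x in ⋂ j, ((S'' j).exterior : Set X''), ENNReal.ofReal (|ζ x| ^ 6) ∂(Literature.Geometry.Lorentzian.riemannianMeasure D''.h)) ^ (1 / 3 : ℝ) ≤ ENNReal.ofReal c₁ * ∫⁻ x in ⋂ j, ((S'' j).exterior : Set X''), ENNReal.ofReal (D''.metric.innerDual x (mvfderiv (𝓡 3) ζ x).toLinearMap (mvfderiv (𝓡 3) ζ x).toLinearMap) ∂(Literature.Geometry.Lorentzian.riemannianMeasure D''.h)) ∧ (∫⁻ x in ⋂ j, ((S'' j).exterior : Set X''), ENNReal.ofReal ((D''.metric.normSq x (D''.metric.ricci x)) ^ (3 / 4 : ℝ)) ∂(Literature.Geometry.Lorentzian.riemannianMeasure D''.h)) + ∑ j,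 (∫⁻ x in Set.range (S'' j).f, ENNReal.ofReal (D''.normSqK x) ∂(Literature.Geometry.Lorentzian.riemannianVolume D''.h 2)) ≤ ENNReal.ofReal Q₀) := by
  sorry

/-- **Composition** `stub C1 → stub C2 → CheapWitnessPerCount` (kernel-checked): for each count `m`,
either no Cauchy slice carries an `m`-family (vacuous) or one does, and then the complete AF carrier
of C1 with the finite cost of C2 serves as the witness for EVERY input family of size `m`. -/
theorem cheapWitnessPerCount_of_statements :
    (∀ (X : Type) [TopologicalSpace X] [ChartedSpace (EuclideanSpace ℝ (Fin 3)) X] [IsManifold (𝓡 3) ((⊤ : ENat) : WithTop ENat) X] [T2Space X] [SecondCountableTopology X] [ConnectedSpace X] (D : Literature.Geometry.Lorentzian.InitialDataSet (𝓡 3) X), D ∈ Literature.Geometry.Lorentzian.admissibleVacuumData X → ∀ 𝒟 : Literature.Geometry.Lorentzian.VacuumCauchyDevelopment D, 𝒟.IsMaximal → ∀ (X' : Type) [TopologicalSpace X'] [ChartedSpace (EuclideanSpace ℝ (Fin 3)) X'] [IsManifold (𝓡 3) ((⊤ : ENat) : WithTop ENat) X'] [ConnectedSpace X'] (D' : Literature.Geometry.Lorentzian.InitialDataSet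 (𝓡 3) X') (𝒟' : Literature.Geometry.Lorentzian.CauchyDevelopment D'), 𝒟'.toSpacetime = 𝒟.toSpacetime → ∀ (m : ℕ) (S : Fin m → Literature.Geometry.Lorentzian.OutermostMOTS (𝓡 3) D'.h D'.k), (∀ j, ConnectedSpace (S j).surf) → (∀ j, IsCompact (((S j).exterior : Set X'))ᶜ ∧ (interior (((S j).exterior : Set X'))ᶜ).Nonempty) → Pairwise (fun j j' ↦ Disjoint (((S j).exterior : Set X'))ᶜ (((S j').exterior : Set X'))ᶜ) → ∃ (X'' : Type) (_ : TopologicalSpace X'') (_ : ChartedSpace (EuclideanSpace ℝ (Fin 3)) X'') (_ : IsManifold (𝓡 3) ((⊤ : ENat) : WithTop ENat) X'') (_ : T2Space X'') (_ : LocallyCompactSpace X'') (_ : MeasurableSpace X'') (_ : BorelSpace X'') (_ : ConnectedSpace X'') (D'' : Literature.Geometry.Lorentzian.InitialDataSet (𝓡 3) X'') (𝒟'' : Literature.Geometry.Lorentzian.CauchyDevelopment D'') (_ : D''.metric.HasLeviCivita), 𝒟''.toSpacetime = 𝒟.toSpacetime ∧ D''.IsComplete ∧ (∃ (e : Literature.Geometry.Lorentzian.AFEnd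 X'') (α : ℝ), 0 < α ∧ e.IsSoleEnd ∧ e.IsMetricAsymptoticallyFlat D'' α) ∧ ∃ S'' : Fin m → Literature.Geometry.Lorentzian.OutermostMOTS (𝓡 3) D''.h D''.k, (∀ j, ConnectedSpace (S'' j).surf) ∧ (∀ j, IsCompact (((S'' j).exterior : Set X''))ᶜ ∧ (interior (((S'' j).exterior : Set X''))ᶜ).Nonempty) ∧ Pairwise (fun j j' ↦ Disjoint (((S'' j).exterior : Set X''))ᶜ (((S'' j').exterior : Set X''))ᶜ)) →
    (∀ (X'' : Type) [TopologicalSpace X''] [ChartedSpace (EuclideanSpace ℝ (Fin 3)) X''] [IsManifold (𝓡 3) ((⊤ : ENat) : WithTop ENat) X''] [T2Space X''] [LocallyCompactSpace X''] [MeasurableSpace X''] [BorelSpace X''] [ConnectedSpace X''] (D'' : Literature.Geometry.Lorentzian.InitialDataSet (𝓡 3) X''), (∀ [D''.metric.HasLeviCivita], D''.IsComplete → (∃ (e : Literature.Geometry.Lorentzian.AFEnd X'') (α : ℝ), 0 < α ∧ e.IsSoleEnd ∧ e.IsMetricAsymptoticallyFlat D'' α) → ∀ (m : ℕ) (S'' :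 Fin m → Literature.Geometry.Lorentzian.OutermostMOTS (𝓡 3) D''.h D''.k), (∀ j, ConnectedSpace (S'' j).surf) → (∀ j, IsCompact (((S'' j).exterior : Set X''))ᶜ ∧ (interior (((S'' j).exterior : Set X''))ᶜ).Nonempty) → Pairwise (fun j j' ↦ Disjoint (((S'' j).exterior : Set X''))ᶜ (((S'' j').exterior : Set X''))ᶜ) → ∃ c₁ Q₀ : ℝ, (∀ ζ : X'' → ℝ, ContMDiff (𝓡 3) 𝓘(ℝ, ℝ) 1 ζ → HasCompactSupport ζ → (∫⁻ x in ⋂ j, ((S'' j).exterior : Set X''), ENNReal.ofReal (|ζ x| ^ 6) ∂(Literature.Geometry.Lorentzian.riemannianMeasure D''.h)) ^ (1 / 3 : ℝ) ≤ ENNReal.ofReal c₁ * ∫⁻ x in ⋂ j, ((S'' j).exterior : Set X''), ENNReal.ofReal (D''.metric.innerDual x (mvfderiv (𝓡 3) ζ x).toLinearMap (mvfderiv (𝓡 3) ζ x).toLinearMap) ∂(Literature.Geometry.Lorentzian.riemannianMeasure D''.h)) ∧ (∫⁻ x in ⋂ j, ((S'' j).exterior : Set X''), ENNReal.ofReal ((D''.metric.normSq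 x (D''.metric.ricci x)) ^ (3 / 4 : ℝ)) ∂(Literature.Geometry.Lorentzian.riemannianMeasure D''.h)) + ∑ j, (∫⁻ x in Set.range (S'' j).f, ENNReal.ofReal (D''.normSqK x) ∂(Literature.Geometry.Lorentzian.riemannianVolume D''.h 2)) ≤ ENNReal.ofReal Q₀)) →
      id CheapWitnessPerCount := by
  intro hC1 hC2
  show CheapWitnessPerCount
  intro X _ _ _ _ _ _ D hD 𝒟 hmax m
  by_cases hex : ∃ (X' : Type) (_ : TopologicalSpace X') (_ : ChartedSpace (EuclideanSpace ℝ (Fin 3)) X') (_ : IsManifold (𝓡 3) ((⊤ : ENat) : WithTop ENat) X') (_ : ConnectedSpace X') (D' : Literature.Geometry.Lorentzian.InitialDataSet (𝓡 3) X') (𝒟' : Literature.Geometry.Lorentzian.CauchyDevelopment D') (_ : 𝒟'.toSpacetime = 𝒟.toSpacetime) (S : Fin m → Literature.Geometry.Lorentzian.OutermostMOTS (𝓡 3) D'.h D'.k), (∀ j, ConnectedSpace (S j).surf) ∧ (∀ j, IsCompact (((S j).exterior : Set X'))ᶜ ∧ (interior (((S j).exterior : Set X'))ᶜ).Nonempty)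 ∧ Pairwise (fun j j' ↦ Disjoint (((S j).exterior : Set X'))ᶜ (((S j').exterior : Set X'))ᶜ)
  · obtain ⟨X', _, _, _, _, D', 𝒟', h𝒟', S, hS, hBd, hdisj⟩ := hex
    obtain ⟨X'', i₁, i₂, i₃, i₄, i₅, i₆, i₇, i₈, D'', 𝒟'', i₉, hsp, hcomp, hAF, S'', hS'', hB'', hdisj''⟩ :=
      hC1 X D hD 𝒟 hmax X' D' 𝒟' h𝒟' m S hS hBd hdisj
    obtain ⟨c₁, Q₀, hsob, hQ⟩ := hC2 X'' D'' hcomp hAF m S'' hS'' hB'' hdisj''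
    exact ⟨c₁, Q₀, fun _ _ _ _ _ _ _ _ _ _ _ _ ↦
      ⟨X'', i₁, i₂, i₃, i₄, i₅, i₆, i₇, i₈, D'', 𝒟'', i₉, hsp, hcomp, S'', hS'', hB'', hdisj'', hsob, hQ⟩⟩
  · refine ⟨0, 0, fun X' _ _ _ _ D' 𝒟' h𝒟' S hS hBd hdisj ↦ ?_⟩
    exact (hex ⟨X', inferInstance, inferInstance, inferInstance, inferInstance, D', 𝒟', h𝒟', S, hS, hBd,
      hdisj⟩).elim

/-- **Composition (skeleton theorem).** The piece `CheapWitnessPerCount` BY NAME and without hypotheses, from the two stubs. -/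
theorem CheapWitnessPerCount_of : CheapWitnessPerCount :=
  cheapWitnessPerCount_of_statements stub_completeAFCarrier stub_finiteCostAF

end Summit.FinalStateConjecture.FinalStateConjecture.Cruxes.BoundedCensusGeometry.Split

end
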